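import Literature.MathematicalPhysics.QuantumManyBody.TorusBoseFockLayer
import Literature.MathematicalPhysics.QuantumManyBody.PeriodicCondensateCoherence
import Literature.MathematicalPhysics.QuantumManyBody.TorusAutocorrelationKernel
import Literature.MathematicalPhysics.QuantumManyBody.BoseGasFreeDirichletBEC
import Literature.MathematicalPhysics.QuantumManyBody.PeriodicFormSpectrum
import Summits.AtomisticToContinuum.BoseEinsteinCondensation.Theorems.BECSubharmonicContinuationFourierRepresentationCell
import HarnessLib

/-!
# Fourier representation of the translation-averaged coherence and of the kinetic coherence
# (route `BECSubharmonicContinuation`, helper for item `ContinuationToPeriodicBEC`, stmt-14585)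

For a periodic trial state `Ψ` of `n+1` bosons on the torus of side `L`
(`PeriodicTrialState`, `PeriodicBoseGas.lean`) and the distinguished particle `0`, the two
correlation functions of the route file `Theses/BECSubharmonicContinuation.lean`,

* `G(y) = Re ∫_{cell^{n+1}} conj Ψ(X with x₀ ↦ x₀ + y) Ψ(X) dX` (translation-averaged one-body
  density matrix) and
* `H(y) = Re Σ_k ∫_{cell^{n+1}} conj ∂_{0,k}Ψ(X with x₀ ↦ x₀ + y) ∂_{0,k}Ψ(X) dX` (kinetic coherence),

are absolutely convergent cosine series over the momentum lattice with the momentum occupations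
`n_m = momentumOccupation (n+1) L m Ψ` of `TorusBoseFockLayer.lean` as weights. This file treats
`G`: `(n+1) G(y) = Σ_m n_m cos(k_m·y)`, `k_m = 2πm/L` (`hasSum_momentumOccupation_cos`, stated
with the wave vectors `waveVector L m` and as a `HasSum`, the form consumed by the sphere-kernel
chain of `ContinuationToPeriodicBEC`); the companion file `…FourierKinetic.lean` treats `H`.
Proof: slice `x ↦ Ψ(x, Y)` (`setIntegral_cellN_succ`), the polarised Parseval identity for a
translate already in the tree (`hasSum_normSq_cellFourierCoeff_mul_cellWave` of
`…FourierRepresentationCell.lean`, i.e. `IMUChainGlue.hasSum_conj_cellFourierCoeff_mul` with the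
shift rule `cellFourierCoeff_translate`), and `integral_tsum` over the remaining particles
(`Σ_m n_m = n + 1`). (A `tsum` form of the same representation for every particle, in terms of
`cellOccupation (planeWaveMode …)`, is `setIntegral_conj_translate_mul_eq_tsum` of
`…BallCriterionFourier.lean`; here the weights are the `momentumOccupation`s of
`TorusBoseFockLayer.lean`, whose depletion and kinetic identities the chain uses.)

References: LSSY 2005 App. A (A.10)–(A.13); Fournais 2020 (3.19)–(3.21). All statements here are
folklore Fourier analysis; no named facts.
-/

noncomputable section

namespace Summit.AtomisticToContinuum.BoseEinsteinCondensation.Theorems.SubharmonicContinuation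

open MeasureTheory Filter Set WithLp Complex
open scoped ENNReal NNReal ComplexConjugate RealInnerProductSpace
open Literature.MathematicalPhysics.QuantumManyBody.BoseGas

section OneParticle

variable {L : ℝ}

/-- `⟪k_m, y⟫ = 2π m·y / L` for the wave vector `k_m = 2πm/L`. [folklore] -/
theorem inner_waveVector (L : ℝ) (m : Fin 3 → ℤ) (y : Space) :
    ⟪waveVector L m, y⟫ = 2 * Real.pi * (∑ j, (m j : ℝ) * y j) / L := by
  rw [PiLp.inner_apply, Finset.mul_sum, Finset.sum_div]
  refine Finset.sum_congr rfl fun j _ => ?_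
  rw [waveVector_apply, real_inner_eq_re_inner ℝ, RCLike.inner_apply, conj_trivial, RCLike.re_to_real]
  ring

/-- The derivative of an `Lℤ³`-periodic function is `Lℤ³`-periodic. [folklore] -/
theorem fderiv_periodic {φ : Space → ℂ}
    (hper : ∀ (x : Space) (k : Fin 3), φ (x + EuclideanSpace.single k L) = φ x) (x : Space)
    (k : Fin 3) : fderiv ℝ φ (x + EuclideanSpace.single k L) = fderiv ℝ φ x := by
  have h : φ = fun z => φ (z + EuclideanSpace.single k L) := funext fun z => (hper z k).symm
  conv_rhs => rw [h]
  rw [fderiv_comp_add_right]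

end OneParticle

section Kinetic

variable {N : ℕ} {L : ℝ}

/-- The kinetic energy of a periodic `C¹` trial state on the fundamental cell is finite
(`|∇Ψ|²` is continuous, hence bounded on the closed box `[0,L]^{3N} ⊇ cell`). [folklore] -/
theorem lintegral_kineticDensity_cellN_lt_top (Ψ : PeriodicTrialState N L) :
    ∫⁻ X in cellN N L, kineticDensity Ψ.ψ X < ⊤ := by
  set g : Config N → ℝ := fun X => ∑ i : Fin N, ∑ k : Fin 3,
    ‖fderiv ℝ Ψ.ψ X (Pi.single i (EuclideanSpace.single k (1 : ℝ)))‖ ^ 2 with hg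
  have hgc : Continuous g := by
    refine continuous_finsetSum _ fun i _ => continuous_finsetSum _ fun k _ => ?_
    exact ((continuous_fderiv_config_single Ψ.contDiff i k).norm).pow 2
  obtain ⟨C, hC⟩ := (isCompact_closedBoxN N L).exists_bound_of_continuousOn hgc.continuousOn
  have hkin : ∀ X, kineticDensity Ψ.ψ X = ENNReal.ofReal (g X) := by
    intro X
    simp only [kineticDensity, hg, coe_nnnorm_sq_eq_ofReal]
    rw [ENNReal.ofReal_sum_of_nonneg (fun i _ => Finset.sum_nonneg fun k _ => by positivity)]
    refine Finset.sum_congr rfl fun i _ => ?_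
    rw [ENNReal.ofReal_sum_of_nonneg (fun k _ => by positivity)]
  have hle : ∀ X ∈ cellN N L, kineticDensity Ψ.ψ X ≤ ENNReal.ofReal C := by
    intro X hX
    rw [hkin]
    refine ENNReal.ofReal_le_ofReal ?_
    have := hC X (cellN_subset_closedBoxN N L hX)
    rw [Real.norm_eq_abs] at this
    exact (le_abs_self _).trans this
  calc ∫⁻ X in cellN N L, kineticDensity Ψ.ψ X
      ≤ ∫⁻ _ in cellN N L, ENNReal.ofReal C := setLIntegral_mono measurable_const hle
    _ = ENNReal.ofReal C * volume (cellN N L) := by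
        rw [setLIntegral_const]
    _ < ⊤ := by
        refine ENNReal.mul_lt_top ENNReal.ofReal_lt_top ?_
        rw [volume_cellN]
        exact ENNReal.pow_lt_top (ENNReal.pow_lt_top ENNReal.ofReal_lt_top)

end Kinetic

section Slices

variable {n : ℕ} {L : ℝ}

/-- **Bochner slice integration on the cell**: `∫_{cell^{n+1}} F = ∫_{cell^n} dY ∫_cell dx F(x, Y)`
for `F` integrable on the cell (Fubini through `MeasurableEquiv.piFinSuccAbove` at slot `0`).
[folklore] -/
theorem setIntegral_cellN_succ (L : ℝ) {F : Config (n + 1) → ℂ}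
    (hF : IntegrableOn F (cellN (n + 1) L) volume) :
    ∫ X in cellN (n + 1) L, F X = ∫ Y in cellN n L, ∫ x in cell L, F (Matrix.vecCons x Y) := by
  set μ : Fin (n + 1) → Measure Space := fun _ => volume.restrict (cell L) with hμ
  have hmp := measurePreserving_piFinSuccAbove μ 0
  have hsymm : ∀ z : Space × Config n,
      (MeasurableEquiv.piFinSuccAbove (fun _ => Space) 0).symm z = Matrix.vecCons z.1 z.2 := by
    rintro ⟨y, Y⟩
    change Fin.insertNth 0 y Y = (Fin.cons y Y : Config (n + 1))
    exact Fin.insertNth_zero' y Y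
  rw [IntegrableOn, volume_restrict_cellN] at hF
  rw [volume_restrict_cellN, volume_restrict_cellN, ← hmp.symm.integral_comp' (g := F)]
  have hint : Integrable (fun z => F ((MeasurableEquiv.piFinSuccAbove (fun _ => Space) 0).symm z))
      ((μ 0).prod (Measure.pi fun j => μ (Fin.succAbove 0 j))) :=
    (hmp.symm.integrable_comp_emb
      (MeasurableEquiv.piFinSuccAbove (fun _ => Space) 0).symm.measurableEmbedding).2 hF
  rw [integral_prod_symm _ hint]
  simp only [hsymm, hμ]

/-- The slice `x ↦ Ψ(x, Y)` of a periodic trial state is `Lℤ³`-periodic. [folklore] -/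
theorem periodic_vecCons_slice (Ψ : PeriodicTrialState (n + 1) L) (Y : Config n) (x : Space)
    (k : Fin 3) : Ψ.ψ (Matrix.vecCons (x + EuclideanSpace.single k L) Y) = Ψ.ψ (Matrix.vecCons x Y) :=
  Ψ.vecCons_add_axis_left x Y k

/-- The sum of the per-slice norms `Σ_m ∫_{cell^n} ‖ĉ_m(Ψ(·,Y))‖² dY` is finite:
`(n+1) L³ ·` it is `Σ_m n_m = n+1`. [folklore] -/
theorem tsum_lintegral_sq_cellFourierCoeff_slice_ne_top (hL : 0 < L)
    (Ψ : PeriodicTrialState (n + 1) L) :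
    ∑' m : Momentum, ∫⁻ Y in cellN n L,
      (‖cellFourierCoeff L (fun x => Ψ.ψ (Matrix.vecCons x Y)) m‖₊ : ℝ≥0∞) ^ 2 ≠ ⊤ := by
  have hL3 : ENNReal.ofReal L ^ 3 ≠ 0 := pow_ne_zero _ (by simpa using hL)
  have h := tsum_momentumOccupation_trialState hL Ψ
  simp only [momentumOccupation_succ hL] at h
  rw [ENNReal.tsum_mul_left, ENNReal.tsum_mul_left] at h
  intro htop
  rw [htop, ENNReal.mul_top hL3, ENNReal.mul_top (by exact_mod_cast Nat.succ_ne_zero n)] at h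
  exact ENNReal.natCast_ne_top (n + 1) h.symm

/-- The per-mode slice norm in terms of the momentum occupation:
`∫_{cell^n} ‖ĉ_m(Ψ(·,Y))‖² dY = n_m / ((n+1) L³)`. [folklore] -/
theorem integral_sq_cellFourierCoeff_slice (hL : 0 < L) (Ψ : PeriodicTrialState (n + 1) L)
    (m : Momentum) :
    ∫ Y in cellN n L, ‖cellFourierCoeff L (fun x => Ψ.ψ (Matrix.vecCons x Y)) m‖ ^ 2 =
      (momentumOccupation (n + 1) L m Ψ.ψ).toReal / ((n + 1) * L ^ 3) := by
  have hL3 : 0 < L ^ 3 := by positivity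
  have hmeas : Measurable fun Y : Config n =>
      (‖cellFourierCoeff L (fun x => Ψ.ψ (Matrix.vecCons x Y)) m‖₊ : ℝ≥0∞) ^ 2 :=
    ((measurable_cellFourierCoeff_vecCons hL m Ψ.contDiff.continuous).nnnorm.coe_nnreal_ennreal).pow_const _
  have hfin : ∫⁻ Y in cellN n L,
      (‖cellFourierCoeff L (fun x => Ψ.ψ (Matrix.vecCons x Y)) m‖₊ : ℝ≥0∞) ^ 2 ≠ ⊤ :=
    ne_top_of_le_ne_top (tsum_lintegral_sq_cellFourierCoeff_slice_ne_top hL Ψ) (ENNReal.le_tsum m)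
  have hrepr : ∫ Y in cellN n L, ‖cellFourierCoeff L (fun x => Ψ.ψ (Matrix.vecCons x Y)) m‖ ^ 2 =
      (∫⁻ Y in cellN n L,
        (‖cellFourierCoeff L (fun x => Ψ.ψ (Matrix.vecCons x Y)) m‖₊ : ℝ≥0∞) ^ 2).toReal := by
    rw [integral_eq_lintegral_of_nonneg_ae (Eventually.of_forall fun Y => by positivity)
      ((measurable_cellFourierCoeff_vecCons hL m Ψ.contDiff.continuous).norm.pow_const _).aestronglyMeasurable]
    congr 1
    refine lintegral_congr fun Y => ?_
    rw [coe_nnnorm_sq_eq_ofReal]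
  rw [hrepr, momentumOccupation_succ hL, ENNReal.toReal_mul, ENNReal.toReal_mul,
    ← ENNReal.ofReal_pow hL.le, ENNReal.toReal_ofReal hL3.le]
  have : ((n : ℝ≥0∞) + 1).toReal = (n : ℝ) + 1 := by
    rw [ENNReal.toReal_add (ENNReal.natCast_ne_top n) ENNReal.one_ne_top]; simp
  rw [this]
  field_simp

end Slices

section Coherence

variable {n : ℕ} {L : ℝ}

/-- **Fourier representation of the translation-averaged coherence** (slot `0`): for a periodic
trial state `Ψ` of `n+1` bosons,
`(n+1) ∫_{cell^{n+1}} conj Ψ(X^{0 → x₀+y}) Ψ(X) dX = Σ_m n_m(Ψ) conj(e_m(y))` as an absolutely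
convergent series over the momentum lattice. [cite: LSSY2005, App. A (A.11)–(A.13)] -/
theorem hasSum_momentumOccupation_conj_cellWave (hL : 0 < L) (Ψ : PeriodicTrialState (n + 1) L)
    (y : Space) :
    HasSum (fun m => ((momentumOccupation (n + 1) L m Ψ.ψ).toReal : ℂ) * conj (cellWave L m y))
      (((n + 1 : ℕ) : ℂ) *
        ∫ X in cellN (n + 1) L, conj (Ψ.ψ (Function.update X 0 (X 0 + y))) * Ψ.ψ X) := by
  have hL3 : (L ^ 3 : ℝ) ≠ 0 := by positivity
  have hcont : Continuous Ψ.ψ := Ψ.contDiff.continuous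
  -- notation for the slices and their coefficients
  set c : Config n → Momentum → ℂ := fun Y m =>
    cellFourierCoeff L (fun x => Ψ.ψ (Matrix.vecCons x Y)) m with hc
  -- Step 1: slice integration
  have hF : Continuous fun X : Config (n + 1) =>
      conj (Ψ.ψ (Function.update X 0 (X 0 + y))) * Ψ.ψ X := by
    refine (Complex.continuous_conj.comp (hcont.comp ?_)).mul hcont
    exact continuous_id.update 0 ((continuous_apply 0).add continuous_const)
  have h1 : ∫ X in cellN (n + 1) L, conj (Ψ.ψ (Function.update X 0 (X 0 + y))) * Ψ.ψ X =
      ∫ Y in cellN n L, ∫ x in cell L,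
        conj (Ψ.ψ (Matrix.vecCons (x + y) Y)) * Ψ.ψ (Matrix.vecCons x Y) := by
    rw [setIntegral_cellN_succ L (integrableOn_cellN_of_continuous L hF)]
    simp only [Matrix.cons_val_zero, update_vecCons_zero]
  -- Step 2: per-slice expansion
  have h2 : ∀ Y : Config n, ∫ x in cell L,
      conj (Ψ.ψ (Matrix.vecCons (x + y) Y)) * Ψ.ψ (Matrix.vecCons x Y) =
        ((L ^ 3 : ℝ) : ℂ) * ∑' m, conj (cellWave L m y) * ((‖c Y m‖ ^ 2 : ℝ) : ℂ) := by
    intro Y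
    have h := hasSum_normSq_cellFourierCoeff_mul_cellWave hL (continuous_vecCons_slice hcont Y)
      (fun x k => periodic_vecCons_slice Ψ Y x k) y
    have h' : HasSum (fun m => conj (cellWave L m y) * ((‖c Y m‖ ^ 2 : ℝ) : ℂ))
        (((L ^ 3)⁻¹ : ℝ) • ∫ x in cell L,
          conj (Ψ.ψ (Matrix.vecCons (x + y) Y)) * Ψ.ψ (Matrix.vecCons x Y)) :=
      h.congr_fun fun m => by rw [conj_cellWave, mul_comm]
    rw [← Complex.real_smul, h'.tsum_eq, smul_smul, mul_inv_cancel₀ hL3, one_smul]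
  simp_rw [h1, h2]
  -- Step 3: exchange the sum and the `Y`-integral
  have hmeas : ∀ m : Momentum, AEStronglyMeasurable
      (fun Y : Config n => conj (cellWave L m y) * ((‖c Y m‖ ^ 2 : ℝ) : ℂ))
      (volume.restrict (cellN n L)) := fun m =>
    (Complex.continuous_ofReal.measurable.comp
      ((measurable_cellFourierCoeff_vecCons hL m hcont).norm.pow_const 2)).aestronglyMeasurable.const_mul _
  have hsum : ∑' m : Momentum, ∫⁻ Y in cellN n L,
      ‖conj (cellWave L m y) * ((‖c Y m‖ ^ 2 : ℝ) : ℂ)‖ₑ ≠ ⊤ := by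
    have h := tsum_lintegral_sq_cellFourierCoeff_slice_ne_top hL Ψ
    refine fun htop => h ?_
    rw [← htop]
    refine tsum_congr fun m => lintegral_congr fun Y => ?_
    have he : ‖conj (cellWave L m y)‖ₑ = 1 := by
      rw [← ofReal_norm, Complex.norm_conj, norm_cellWave, ENNReal.ofReal_one]
    rw [enorm_mul, he, one_mul, ← ofReal_norm, Complex.norm_real, Real.norm_of_nonneg (by positivity),
      ← coe_nnnorm_sq_eq_ofReal]
  rw [integral_const_mul, integral_tsum hmeas hsum]
  -- Step 4: evaluate each mode
  have h4 : ∀ m : Momentum, ∫ Y in cellN n L, conj (cellWave L m y) * ((‖c Y m‖ ^ 2 : ℝ) : ℂ) =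
      conj (cellWave L m y) *
        (((momentumOccupation (n + 1) L m Ψ.ψ).toReal / ((n + 1) * L ^ 3) : ℝ) : ℂ) := by
    intro m
    rw [integral_const_mul, integral_complex_ofReal, integral_sq_cellFourierCoeff_slice hL Ψ m]
  simp_rw [h4]
  -- Step 5: summability and the value of the sum
  have hsumm : Summable fun m : Momentum => (momentumOccupation (n + 1) L m Ψ.ψ).toReal :=
    ENNReal.summable_toReal (by rw [tsum_momentumOccupation_trialState hL Ψ]; exact ENNReal.natCast_ne_top _)
  have hsummC : Summable fun m : Momentum =>
      ((momentumOccupation (n + 1) L m Ψ.ψ).toReal : ℂ) * conj (cellWave L m y) := by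
    refine Summable.of_norm_bounded (g := fun m => (momentumOccupation (n + 1) L m Ψ.ψ).toReal)
      hsumm fun m => ?_
    rw [norm_mul, Complex.norm_real, Complex.norm_conj, norm_cellWave, mul_one, Real.norm_of_nonneg
      ENNReal.toReal_nonneg]
  have hLc : (L : ℂ) ≠ 0 := by exact_mod_cast hL.ne'
  have hn1 : ((n : ℂ) + 1) ≠ 0 := by exact_mod_cast Nat.succ_ne_zero n
  have key : ∀ m : Momentum, ((momentumOccupation (n + 1) L m Ψ.ψ).toReal : ℂ) * conj (cellWave L m y) =
      ((n + 1 : ℕ) : ℂ) * (((L ^ 3 : ℝ) : ℂ) * (conj (cellWave L m y) *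
        (((momentumOccupation (n + 1) L m Ψ.ψ).toReal / ((n + 1) * L ^ 3) : ℝ) : ℂ))) := by
    intro m
    push_cast
    field_simp
  rw [← tsum_mul_left, ← tsum_mul_left]
  have htsum : (∑' m : Momentum, ((n + 1 : ℕ) : ℂ) * (((L ^ 3 : ℝ) : ℂ) * (conj (cellWave L m y) *
      (((momentumOccupation (n + 1) L m Ψ.ψ).toReal / ((n + 1) * L ^ 3) : ℝ) : ℂ)))) =
      ∑' m : Momentum, ((momentumOccupation (n + 1) L m Ψ.ψ).toReal : ℂ) * conj (cellWave L m y) :=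
    tsum_congr fun m => (key m).symm
  rw [htsum]
  exact hsummC.hasSum

/-- **`(n+1) G(y) = Σ_m n_m cos(k_m·y)`** — the translation-averaged one-body density matrix of the
route file (slot `0`) as a cosine series with the momentum occupations as weights.
[cite: LSSY2005, App. A (A.11)–(A.13)] -/
theorem hasSum_momentumOccupation_cos (hL : 0 < L) (Ψ : PeriodicTrialState (n + 1) L) (y : Space) :
    HasSum (fun m => (momentumOccupation (n + 1) L m Ψ.ψ).toReal * Real.cos ⟪waveVector L m, y⟫)
      ((n + 1 : ℝ) *
        (∫ X in cellN (n + 1) L, conj (Ψ.ψ (Function.update X 0 (X 0 + y))) * Ψ.ψ X).re) := by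
  have h := (hasSum_momentumOccupation_conj_cellWave hL Ψ y).mapL Complex.reCLM
  simp only [Complex.reCLM_apply] at h
  convert h using 1
  · funext m
    rw [Complex.re_ofReal_mul, Complex.conj_re, re_cellWave, inner_waveVector]
  · rw [show ((n + 1 : ℕ) : ℂ) = ((n + 1 : ℝ) : ℂ) by push_cast; ring, Complex.re_ofReal_mul]

end Coherence

end Summit.AtomisticToContinuum.BoseEinsteinCondensation.Theorems.SubharmonicContinuation

end
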